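import Literature.NumberTheory.Transcendental.BrownIharaGroupLaw
import HarnessLib

/-!
# The infinitesimal Ihara action and its iterates (derivation algebra of `ℚ⟨⟨e₀, e₁⟩⟩`)

Generic algebra on the non-commutative series `WordSeries S B = B⟨⟨S⟩⟩` of
`GoncharovFormalIteratedIntegralsProofs.lean`, used by `BrownMotivicOrbitGenerators.lean` to
INTEGRATE the infinitesimal Ihara action of arbitrary Lie generators (freeness of the motivic Lie
algebra, [Brown2012, §2.5]; [DeligneGoncharov2005, Prop. 2.3, 5.8–5.12]):

* `dWord θ c`, `derivW θ x` — the continuous derivation of `B⟨⟨S⟩⟩` with prescribed values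
  `θ k` on the letters (`derivW_mul`: Leibniz), as a contraction against the kernel
  `dWord θ c = Σᵢ c_{<i} θ(cᵢ) c_{>i}`;
* `θIhara ψ`, `derivI ψ`, `sI ψ` — Ihara's derivation `D_ψ : e₀ ↦ 0, e₁ ↦ ψ e₁ - e₁ ψ` and the
  **infinitesimal Ihara action** `s_ψ(x) = x·ψ + D_ψ(x)` (the derivative at `a = 1 + εψ` of
  Ihara's law `a ⋆ x = ⟨a⟩(x)·a`, `⟨a⟩ : e₀ ↦ e₀, e₁ ↦ a e₁ a⁻¹`, of `BrownIharaGroupLaw.lean`,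
  [DG05, (5.11.4)–(5.12.1)] in Brown's orientation of words), with the twisted Leibniz rule
  `s_ψ(xy) = D_ψ(x) y + x s_ψ(y)` (`sI_mul`) and `s_ψ(x e₁) = s_ψ(x) e₁` (`sI_mul_X_true`);
* `DW τ W`, `SW τ W`, `PW τ W` — the iterates `D_{τ_{a₁}} ∘ ⋯ ∘ D_{τ_{a_k}}`,
  `s_{τ_{a₁}} ∘ ⋯ ∘ s_{τ_{a_k}}` over a word `W = a₁ ⋯ a_k` of generators `τ : ℕ → B⟨⟨e₀,e₁⟩⟩`, and
  the polynomials `P_W = s_W(1)`, with the iterated Leibniz rules over deshuffles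
  (`DW_mul`, `SW_mul`);
* `IsLocal` — operators reading only the coefficients of subwords (`isLocal_SW`: each `s_W` is
  local, so it commutes with the infinite sums of the orbit computation);
* weights (`IsWt`) and the **coderivation property** of `s_ψ` for a PRIMITIVE `ψ`
  (`delta_sI_of_isWt`: `δ ∘ s_ψ = (s_ψ ⊗ 1 + 1 ⊗ s_ψ) ∘ δ`), whence
  `delta_PW`: `δ P_W = Σ_{(U,V) deshuffle of W} P_U ⊗ P_V`, i.e. `W ↦ P_W` is a coalgebra map —
  the transpose statement of "the orbit map of the unit is a shuffle character".

No definition of a notion of the sources is introduced beyond these operators; no named fact.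

## References

* P. Deligne, A. B. Goncharov, *Groupes fondamentaux motiviques de Tate mixte*, Ann. Sci. ÉNS 38
  (2005), 5.8–5.12; arXiv:math/0302267. [DeligneGoncharov2005]
* F. Brown, *Mixed Tate motives over ℤ*, Ann. of Math. 175 (2012), §2.1, §2.5; arXiv:1102.1312.
  [Brown2012]
* C. Reutenauer, *Free Lie algebras*, Oxford 1993, Ch. 1 (shuffles, deshuffle coproduct,
  primitive elements). [Reutenauer1993]
-/

noncomputable section

open scoped BigOperators

namespace Literature.NumberTheory.Transcendental

namespace GoncharovFormalIteratedIntegrals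

universe u v

variable {S : Type u} {B : Type v} [CommRing B] [DecidableEq S]

open WordSeries

/-! ## Small complements on word monomials and contractions -/

/-- `wordX (c d) = wordX c · wordX d`. [folklore] -/
theorem wordX_append : ∀ (c d : List S), (wordX (c ++ d) : WordSeries S B) = wordX c * wordX d
  | [], d => by rw [List.nil_append, wordX_nil, one_mul]
  | k :: c, d => by rw [List.cons_append, wordX_cons, wordX_cons, wordX_append c d, mul_assoc]

/-- A non-zero coefficient of `wordX c` sits at `c`. [folklore] -/
theorem eq_of_wordX_apply_ne_zero {c w : List S} (h : (wordX c : WordSeries S B) w ≠ 0) : w = c := by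
  rw [wordX_apply] at h
  by_contra hne
  exact h (if_neg hne)

/-- `wordX` is a triangular family. [folklore] -/
theorem wordX_apply_ne_zero (c w : List S) (h : (wordX c : WordSeries S B) w ≠ 0) :
    List.Sublist c w := by
  rw [eq_of_wordX_apply_ne_zero h]

/-- A non-zero coefficient of a letter sits at that letter. [folklore] -/
theorem eq_of_X_apply_ne_zero {k : S} {w : List S} (h : (X k : WordSeries S B) w ≠ 0) : w = [k] := by
  rw [X_apply] at h
  by_contra hne
  exact h (if_neg hne)

omit [DecidableEq S] in
/-- A non-zero coefficient of a product comes from a cut with both factors non-zero. [folklore] -/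
theorem exists_take_drop_ne_zero {f g : WordSeries S B} {w : List S} (h : (f * g) w ≠ 0) :
    ∃ k, f (w.take k) ≠ 0 ∧ g (w.drop k) ≠ 0 := by
  rw [mul_apply] at h
  obtain ⟨k, -, hk⟩ := Finset.exists_ne_zero_of_sum_ne_zero h
  exact ⟨k, left_ne_zero_of_mul hk, right_ne_zero_of_mul hk⟩

/-- Contracting a word monomial against a triangular family picks out one member:
`⟨X_c, Ω⟩ = Ω(c)`. [folklore] -/
theorem contr_wordX_left (c : List S) {Ω : List S → WordSeries S B}
    (hΩ : ∀ c w, Ω c w ≠ 0 → List.Sublist c w) : contr (wordX c) Ω = Ω c := by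
  ext w
  rw [contr_apply]
  simp_rw [wordX_apply, ite_mul, one_mul, zero_mul]
  rw [Finset.sum_ite_eq']
  split_ifs with h
  · rfl
  · by_contra hne
    exact h (mem_subwords.2 (hΩ _ _ (Ne.symm hne)))

/-- `⟨1, Ω⟩ = Ω(∅)`. [folklore] -/
theorem contr_one_left {Ω : List S → WordSeries S B}
    (hΩ : ∀ c w, Ω c w ≠ 0 → List.Sublist c w) : contr (1 : WordSeries S B) Ω = Ω [] := by
  rw [← wordX_nil]
  exact contr_wordX_left [] hΩ

/-- `contr` is additive in the weight. [folklore] -/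
theorem contr_add_left (φ φ' : WordSeries S B) (Ω : List S → WordSeries S B) :
    contr (φ + φ') Ω = contr φ Ω + contr φ' Ω := by
  ext w
  simp only [contr_apply, WordSeries.add_apply, add_mul, Finset.sum_add_distrib]

/-- `contr` is additive in the family. [folklore] -/
theorem contr_add_right (φ : WordSeries S B) (Ω Ω' : List S → WordSeries S B) :
    (contr φ fun c => Ω c + Ω' c) = contr φ Ω + contr φ Ω' := by
  ext w
  simp only [contr_apply, WordSeries.add_apply, mul_add, Finset.sum_add_distrib]

/-- `⟨0, Ω⟩ = 0`. [folklore] -/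
@[simp] theorem contr_zero_left (Ω : List S → WordSeries S B) : contr (0 : WordSeries S B) Ω = 0 := by
  ext w
  simp [contr_apply]

/-- `contr` is `B`-linear in the weight. [folklore] -/
theorem contr_C_mul_left (r : B) (φ : WordSeries S B) (Ω : List S → WordSeries S B) :
    contr (C r * φ) Ω = C r * contr φ Ω := by
  ext w
  simp only [contr_apply, C_mul_apply, Finset.mul_sum, mul_assoc]

omit [DecidableEq S] in
/-- Constants are central in `B⟨⟨S⟩⟩` (`B` commutative). [folklore] -/
theorem mul_C_comm (x : WordSeries S B) (r : B) : x * C r = C r * x := by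
  ext w
  rw [C_mul_apply, mul_apply, Finset.sum_eq_single_of_mem w.length
    (Finset.mem_range.2 (Nat.lt_succ_self _)) fun k hk hne => ?_]
  · rw [List.take_length, List.drop_length, C_nil, mul_comm]
  · have hk' : k < w.length := lt_of_le_of_ne (Nat.lt_succ_iff.1 (Finset.mem_range.1 hk)) hne
    have hne' : w.drop k ≠ [] := by rw [Ne, List.drop_eq_nil_iff]; omega
    obtain ⟨s, u, hsu⟩ := List.exists_cons_of_ne_nil hne'
    rw [hsu, C_cons, mul_zero]

/-! ## Derivations with prescribed values on letters -/

section Deriv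

variable (θ : S → WordSeries S B)

/-- The kernel of the derivation: `dWord θ (c₁ ⋯ c_k) = Σᵢ c₁⋯cᵢ₋₁ · θ(cᵢ) · cᵢ₊₁⋯c_k`, the
image of the word monomial under the derivation `e_k ↦ θ(k)`. [folklore] -/
def dWord : List S → WordSeries S B
  | [] => 0
  | k :: c => θ k * wordX c + X k * dWord c

/-- `dWord θ ∅ = 0`. [folklore] -/
@[simp] theorem dWord_nil : dWord θ ([] : List S) = 0 := rfl

/-- `dWord θ (k c) = θ(k)·wordX c + X_k · dWord θ c`. [folklore] -/
theorem dWord_cons (k : S) (c : List S) : dWord θ (k :: c) = θ k * wordX c + X k * dWord θ c := rfl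

/-- `dWord θ k = θ(k)`. [folklore] -/
theorem dWord_singleton (k : S) : dWord θ [k] = θ k := by
  rw [dWord_cons, dWord_nil, wordX_nil, mul_one, mul_zero, add_zero]

/-- **Leibniz on words**: `dWord θ (c d) = dWord θ c · wordX d + wordX c · dWord θ d`. [folklore] -/
theorem dWord_append : ∀ (c d : List S),
    dWord θ (c ++ d) = dWord θ c * wordX d + wordX c * dWord θ d
  | [], d => by rw [List.nil_append, dWord_nil, zero_mul, zero_add, wordX_nil, one_mul]
  | k :: c, d => by
    rw [List.cons_append, dWord_cons, dWord_cons, wordX_cons, wordX_append, dWord_append c d]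
    simp only [mul_add, add_mul, mul_assoc, add_assoc]

/-- **Triangularity of the kernel**: if every `θ(k)` is supported on words containing the letter
`k`, then `dWord θ c` is supported on words containing `c` as a subword. [folklore] -/
theorem dWord_apply_ne_zero (hθ : ∀ k w, θ k w ≠ 0 → List.Sublist [k] w) :
    ∀ (c w : List S), dWord θ c w ≠ 0 → List.Sublist c w
  | [], _, h => absurd rfl h
  | k :: c, w, h => by
    rw [dWord_cons, WordSeries.add_apply] at h
    by_cases h1 : (θ k * wordX c : WordSeries S B) w = 0
    · rw [h1, zero_add] at h
      cases w with
      | nil => exact absurd (X_mul_apply_nil k _) h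
      | cons s w =>
        rw [X_mul_apply_cons] at h
        split_ifs at h with hs
        · subst hs
          exact (dWord_apply_ne_zero hθ c w h).cons_cons s
        · exact absurd rfl h
    · obtain ⟨j, hj1, hj2⟩ := exists_take_drop_ne_zero h1
      have h3 : w.drop j = c := eq_of_wordX_apply_ne_zero hj2
      have h4 : List.Sublist ([k] ++ c) (w.take j ++ w.drop j) :=
        (hθ k _ hj1).append (h3 ▸ List.Sublist.refl _)
      rwa [List.take_append_drop] at h4

/-- **The derivation** `derivW θ` of `B⟨⟨S⟩⟩` extending `e_k ↦ θ(k)` continuously: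
`derivW θ x = Σ_c x(c) · dWord θ c`. [folklore] -/
def derivW (x : WordSeries S B) : WordSeries S B := contr x (dWord θ)

variable {θ}

/-- `derivW θ` on a word monomial. [folklore] -/
theorem derivW_wordX (hθ : ∀ k w, θ k w ≠ 0 → List.Sublist [k] w) (c : List S) :
    derivW θ (wordX c) = dWord θ c :=
  contr_wordX_left c (dWord_apply_ne_zero θ hθ)

/-- `derivW θ (X_k) = θ(k)`. [folklore] -/
theorem derivW_X (hθ : ∀ k w, θ k w ≠ 0 → List.Sublist [k] w) (k : S) : derivW θ (X k) = θ k := by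
  rw [derivW, contr_X k (dWord_apply_ne_zero θ hθ), dWord_singleton]

/-- `derivW θ 1 = 0`. [folklore] -/
theorem derivW_one (hθ : ∀ k w, θ k w ≠ 0 → List.Sublist [k] w) :
    derivW θ (1 : WordSeries S B) = 0 := by
  rw [derivW, contr_one_left (dWord_apply_ne_zero θ hθ), dWord_nil]

variable (θ)

/-- `derivW θ` is additive. [folklore] -/
theorem derivW_add (x y : WordSeries S B) : derivW θ (x + y) = derivW θ x + derivW θ y :=
  contr_add_left x y _

/-- `derivW θ 0 = 0`. [folklore] -/
@[simp] theorem derivW_zero : derivW θ (0 : WordSeries S B) = 0 := contr_zero_left _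

/-- `derivW θ` is `B`-linear. [folklore] -/
theorem derivW_C_mul (r : B) (x : WordSeries S B) : derivW θ (C r * x) = C r * derivW θ x :=
  contr_C_mul_left r x _

/-- `derivW θ` as an additive map. [folklore] -/
def derivWHom : WordSeries S B →+ WordSeries S B where
  toFun := derivW θ
  map_zero' := derivW_zero θ
  map_add' := derivW_add θ

/-- `derivWHom θ x = derivW θ x`. [folklore] -/
@[simp] theorem derivWHom_apply (x : WordSeries S B) : derivWHom θ x = derivW θ x := rfl

variable {θ}

/-- **Leibniz**: `derivW θ (xy) = derivW θ x · y + x · derivW θ y` on all series (the continuous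
extension of the derivation on words, `dWord_append`). [folklore] -/
theorem derivW_mul (hθ : ∀ k w, θ k w ≠ 0 → List.Sublist [k] w) (x y : WordSeries S B) :
    derivW θ (x * y) = derivW θ x * y + x * derivW θ y := by
  have hd := dWord_apply_ne_zero θ hθ
  have hX : ∀ c w, (wordX c : WordSeries S B) w ≠ 0 → List.Sublist c w := wordX_apply_ne_zero
  rw [derivW, contr_mul x y hd]
  have h1 : (fun d => contr y fun e => dWord θ (d ++ e)) =
      fun d => dWord θ d * y + wordX d * derivW θ y := by
    funext d
    simp_rw [dWord_append]
    rw [contr_add_right, contr_const_mul y (dWord θ d) hX, contr_wordX,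
      contr_const_mul y (wordX d) hd, derivW]
  rw [h1, contr_add_right, contr_mul_const x y hd,
    contr_mul_const x (derivW θ y) hX, contr_wordX, derivW, derivW]

end Deriv

/-! ## Ihara's derivations `D_ψ` and the infinitesimal Ihara action `s_ψ` -/

section Ihara

variable (ψ : WordSeries Bool B)

/-- The values on letters of Ihara's derivation `D_ψ`: `e₀ ↦ 0`, `e₁ ↦ ψ e₁ - e₁ ψ` — the
derivative at `a = 1 + εψ` of Ihara's substitution `⟨a⟩ : e₀ ↦ e₀, e₁ ↦ a e₁ a⁻¹`
([DG05, (5.11.4)] in Brown's orientation). [cite: DeligneGoncharov2005, (5.11.4)] -/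
def θIhara : Bool → WordSeries Bool B
  | true => ψ * X true - X true * ψ
  | false => 0

/-- `θIhara ψ 0 = 0`. [folklore] -/
@[simp] theorem θIhara_false : θIhara ψ false = 0 := rfl

/-- `θIhara ψ 1 = ψ e₁ - e₁ ψ`. [folklore] -/
theorem θIhara_true : θIhara ψ true = ψ * X true - X true * ψ := rfl

/-- The values `θIhara ψ k` are supported on words containing the letter `k`. [folklore] -/
theorem θIhara_apply_ne_zero : ∀ (k : Bool) (w : List Bool), θIhara ψ k w ≠ 0 → List.Sublist [k] w
  | false, _, h => absurd rfl h
  | true, w, h => by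
    rw [θIhara_true, WordSeries.sub_apply] at h
    by_cases h1 : (ψ * X true : WordSeries Bool B) w = 0
    · rw [h1, zero_sub, neg_ne_zero] at h
      cases w with
      | nil => exact absurd (X_mul_apply_nil true ψ) h
      | cons s w =>
        rw [X_mul_apply_cons] at h
        split_ifs at h with hs
        · subst hs
          exact (List.nil_sublist w).cons_cons true
        · exact absurd rfl h
    · obtain ⟨j, -, hj2⟩ := exists_take_drop_ne_zero h1
      have h3 : w.drop j = [true] := eq_of_X_apply_ne_zero hj2
      exact h3 ▸ List.drop_sublist j w

/-- **Ihara's derivation** `D_ψ` of `B⟨⟨e₀,e₁⟩⟩`: `e₀ ↦ 0`, `e₁ ↦ ψ e₁ - e₁ ψ`.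
[cite: DeligneGoncharov2005, (5.11.4)] -/
def derivI (x : WordSeries Bool B) : WordSeries Bool B := derivW (θIhara ψ) x

/-- **The infinitesimal Ihara action** `s_ψ(x) = x·ψ + D_ψ(x)`: the derivative at `a = 1 + εψ`
of Ihara's law `a ⋆ x = ⟨a⟩(x)·a` of `BrownIharaGroupLaw.lean` ([DG05, (5.11.5), (5.12.1)] in
Brown's orientation of words). [cite: DeligneGoncharov2005, (5.11.5), (5.12.1)] -/
def sI (x : WordSeries Bool B) : WordSeries Bool B := x * ψ + derivI ψ x

/-- `D_ψ(X₀) = 0`. [cite: DeligneGoncharov2005, (5.11.1)] -/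
@[simp] theorem derivI_X_false : derivI ψ (X false) = 0 := by
  rw [derivI, derivW_X (θIhara_apply_ne_zero ψ)]; rfl

/-- `D_ψ(X₁) = ψ e₁ - e₁ ψ`. [cite: DeligneGoncharov2005, (5.11.2), (5.11.4)] -/
theorem derivI_X_true : derivI ψ (X true) = ψ * X true - X true * ψ := by
  rw [derivI, derivW_X (θIhara_apply_ne_zero ψ)]; rfl

/-- `D_ψ(1) = 0`. [folklore] -/
@[simp] theorem derivI_one : derivI ψ (1 : WordSeries Bool B) = 0 :=
  derivW_one (θIhara_apply_ne_zero ψ)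

/-- `D_ψ(0) = 0`. [folklore] -/
@[simp] theorem derivI_zero : derivI ψ (0 : WordSeries Bool B) = 0 := derivW_zero _

/-- `D_ψ` is additive. [folklore] -/
theorem derivI_add (x y : WordSeries Bool B) : derivI ψ (x + y) = derivI ψ x + derivI ψ y :=
  derivW_add _ x y

/-- `D_ψ` is `B`-linear. [folklore] -/
theorem derivI_C_mul (r : B) (x : WordSeries Bool B) : derivI ψ (C r * x) = C r * derivI ψ x :=
  derivW_C_mul _ r x

/-- **Leibniz** for `D_ψ`. [folklore] -/
theorem derivI_mul (x y : WordSeries Bool B) : derivI ψ (x * y) = derivI ψ x * y + x * derivI ψ y :=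
  derivW_mul (θIhara_apply_ne_zero ψ) x y

/-- `D_ψ` on a word monomial is its kernel. [folklore] -/
theorem derivI_wordX (c : List Bool) : derivI ψ (wordX c) = dWord (θIhara ψ) c :=
  derivW_wordX (θIhara_apply_ne_zero ψ) c

/-- `D_ψ(x e₀) = D_ψ(x) e₀`. [folklore] -/
theorem derivI_mul_X_false (x : WordSeries Bool B) : derivI ψ (x * X false) = derivI ψ x * X false := by
  rw [derivI_mul, derivI_X_false, mul_zero, add_zero]

/-- `s_ψ(1) = ψ` (the orbit of the unit starts at the generator). [folklore] -/
@[simp] theorem sI_one : sI ψ (1 : WordSeries Bool B) = ψ := by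
  rw [sI, one_mul, derivI_one, add_zero]

/-- `s_ψ(0) = 0`. [folklore] -/
@[simp] theorem sI_zero : sI ψ (0 : WordSeries Bool B) = 0 := by
  rw [sI, zero_mul, derivI_zero, add_zero]

/-- `s_ψ` is additive. [folklore] -/
theorem sI_add (x y : WordSeries Bool B) : sI ψ (x + y) = sI ψ x + sI ψ y := by
  rw [sI, sI, sI, add_mul, derivI_add]; abel

/-- `s_ψ` is `B`-linear. [folklore] -/
theorem sI_C_mul (r : B) (x : WordSeries Bool B) : sI ψ (C r * x) = C r * sI ψ x := by
  rw [sI, sI, derivI_C_mul, mul_assoc, mul_add]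

/-- **Twisted Leibniz rule**: `s_ψ(xy) = D_ψ(x)·y + x·s_ψ(y)`. [folklore] -/
theorem sI_mul (x y : WordSeries Bool B) : sI ψ (x * y) = derivI ψ x * y + x * sI ψ y := by
  rw [sI, sI, derivI_mul]
  simp only [mul_add, mul_assoc]
  abel

/-- **`s_ψ` commutes with right multiplication by `e₁`**: `s_ψ(x e₁) = s_ψ(x) e₁` (the terms
`x e₁ ψ` and `-x e₁ ψ` cancel). [folklore] -/
theorem sI_mul_X_true (x : WordSeries Bool B) : sI ψ (x * X true) = sI ψ x * X true := by
  rw [sI, sI, derivI_mul, derivI_X_true]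
  simp only [mul_sub, add_mul, mul_assoc]
  abel

/-- `s_ψ` as an additive map. [folklore] -/
def sIHom : WordSeries Bool B →+ WordSeries Bool B where
  toFun := sI ψ
  map_zero' := sI_zero ψ
  map_add' := sI_add ψ

/-- `sIHom ψ x = sI ψ x`. [folklore] -/
@[simp] theorem sIHom_apply (x : WordSeries Bool B) : sIHom ψ x = sI ψ x := rfl

/-- `D_ψ` as an additive map. [folklore] -/
def derivIHom : WordSeries Bool B →+ WordSeries Bool B where
  toFun := derivI ψ
  map_zero' := derivI_zero ψ
  map_add' := derivI_add ψ

/-- `derivIHom ψ x = derivI ψ x`. [folklore] -/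
@[simp] theorem derivIHom_apply (x : WordSeries Bool B) : derivIHom ψ x = derivI ψ x := rfl

end Ihara

/-! ## Iterates over words of generators -/

section Iterates

variable (τ : ℕ → WordSeries Bool B)

/-- `D_W = D_{τ_{a₁}} ∘ ⋯ ∘ D_{τ_{a_k}}` for `W = a₁ ⋯ a_k`. [folklore] -/
def DW : List ℕ → WordSeries Bool B → WordSeries Bool B
  | [] => fun x => x
  | a :: W => fun x => derivI (τ a) (DW W x)

/-- `s_W = s_{τ_{a₁}} ∘ ⋯ ∘ s_{τ_{a_k}}` for `W = a₁ ⋯ a_k`: the action of the monomial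
`F_{a₁} ⋯ F_{a_k}` of the enveloping algebra of the free Lie algebra on the generators.
[cite: Brown2012, §2.5; DeligneGoncharov2005, Prop. 2.3] -/
def SW : List ℕ → WordSeries Bool B → WordSeries Bool B
  | [] => fun x => x
  | a :: W => fun x => sI (τ a) (SW W x)

/-- **The polynomials `P_W = s_W(1)`**: the coefficients, on the monomial `F_W` of
`𝒰' = 𝒪(G_𝒰)`, of the orbit map `g ↦ g·₀1₁` of the unit path. [cite: Brown2012, §2.1 (2.4),
(2.6), §2.5] -/
def PW (W : List ℕ) : WordSeries Bool B := SW τ W 1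

/-- `D_∅ = id`. [folklore] -/
@[simp] theorem DW_nil (x : WordSeries Bool B) : DW τ [] x = x := rfl

/-- `D_{aW} = D_{τ a} ∘ D_W`. [folklore] -/
theorem DW_cons (a : ℕ) (W : List ℕ) (x : WordSeries Bool B) :
    DW τ (a :: W) x = derivI (τ a) (DW τ W x) := rfl

/-- `s_∅ = id`. [folklore] -/
@[simp] theorem SW_nil (x : WordSeries Bool B) : SW τ [] x = x := rfl

/-- `s_{aW} = s_{τ a} ∘ s_W`. [folklore] -/
theorem SW_cons (a : ℕ) (W : List ℕ) (x : WordSeries Bool B) :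
    SW τ (a :: W) x = sI (τ a) (SW τ W x) := rfl

/-- `P_∅ = 1`. [folklore] -/
@[simp] theorem PW_nil : PW τ [] = 1 := rfl

/-- `P_{aW} = s_{τ a}(P_W)`. [folklore] -/
theorem PW_cons (a : ℕ) (W : List ℕ) : PW τ (a :: W) = sI (τ a) (PW τ W) := rfl

/-- `s_{UV} = s_U ∘ s_V`. [folklore] -/
theorem SW_append : ∀ (U V : List ℕ) (x : WordSeries Bool B), SW τ (U ++ V) x = SW τ U (SW τ V x)
  | [], _, _ => rfl
  | a :: U, V, x => by rw [List.cons_append, SW_cons, SW_cons, SW_append U V x]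

/-- `D_W(0) = 0`. [folklore] -/
@[simp] theorem DW_zero : ∀ W : List ℕ, DW τ W (0 : WordSeries Bool B) = 0
  | [] => rfl
  | a :: W => by rw [DW_cons, DW_zero W, derivI_zero]

/-- `s_W(0) = 0`. [folklore] -/
@[simp] theorem SW_zero : ∀ W : List ℕ, SW τ W (0 : WordSeries Bool B) = 0
  | [] => rfl
  | a :: W => by rw [SW_cons, SW_zero W, sI_zero]

/-- `D_W` is additive. [folklore] -/
theorem DW_add : ∀ (W : List ℕ) (x y : WordSeries Bool B), DW τ W (x + y) = DW τ W x + DW τ W y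
  | [], _, _ => rfl
  | a :: W, x, y => by rw [DW_cons, DW_cons, DW_cons, DW_add W, derivI_add]

/-- `s_W` is additive. [folklore] -/
theorem SW_add : ∀ (W : List ℕ) (x y : WordSeries Bool B), SW τ W (x + y) = SW τ W x + SW τ W y
  | [], _, _ => rfl
  | a :: W, x, y => by rw [SW_cons, SW_cons, SW_cons, SW_add W, sI_add]

/-- `D_W` is `B`-linear. [folklore] -/
theorem DW_C_mul (r : B) : ∀ (W : List ℕ) (x : WordSeries Bool B), DW τ W (C r * x) = C r * DW τ W x
  | [], _ => rfl
  | a :: W, x => by rw [DW_cons, DW_cons, DW_C_mul r W, derivI_C_mul]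

/-- `s_W` is `B`-linear. [folklore] -/
theorem SW_C_mul (r : B) : ∀ (W : List ℕ) (x : WordSeries Bool B), SW τ W (C r * x) = C r * SW τ W x
  | [], _ => rfl
  | a :: W, x => by rw [SW_cons, SW_cons, SW_C_mul r W, sI_C_mul]

/-- `D_W` as an additive map. [folklore] -/
def DWHom (W : List ℕ) : WordSeries Bool B →+ WordSeries Bool B where
  toFun := DW τ W
  map_zero' := DW_zero τ W
  map_add' := DW_add τ W

/-- `DWHom τ W x = DW τ W x`. [folklore] -/
@[simp] theorem DWHom_apply (W : List ℕ) (x : WordSeries Bool B) : DWHom τ W x = DW τ W x := rfl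

/-- `s_W` as an additive map. [folklore] -/
def SWHom (W : List ℕ) : WordSeries Bool B →+ WordSeries Bool B where
  toFun := SW τ W
  map_zero' := SW_zero τ W
  map_add' := SW_add τ W

/-- `SWHom τ W x = SW τ W x`. [folklore] -/
@[simp] theorem SWHom_apply (W : List ℕ) (x : WordSeries Bool B) : SWHom τ W x = SW τ W x := rfl

/-- `D_W(1) = 0` for `W ≠ ∅`. [folklore] -/
theorem DW_one_of_ne_nil : ∀ {W : List ℕ}, W ≠ [] → DW τ W (1 : WordSeries Bool B) = 0
  | [], h => absurd rfl h
  | [_], _ => by rw [DW_cons, DW_nil, derivI_one]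
  | a :: b :: W, _ => by rw [DW_cons, DW_one_of_ne_nil (List.cons_ne_nil b W), derivI_zero]

/-- `D_W(e₀) = 0` for `W ≠ ∅`. [cite: DeligneGoncharov2005, (5.11.1)] -/
theorem DW_X_false_of_ne_nil : ∀ {W : List ℕ}, W ≠ [] → DW τ W (X false : WordSeries Bool B) = 0
  | [], h => absurd rfl h
  | [_], _ => by rw [DW_cons, DW_nil, derivI_X_false]
  | a :: b :: W, _ => by rw [DW_cons, DW_X_false_of_ne_nil (List.cons_ne_nil b W), derivI_zero]

/-- `s_W(x e₁) = s_W(x) e₁`. [folklore] -/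
theorem SW_mul_X_true : ∀ (W : List ℕ) (x : WordSeries Bool B), SW τ W (x * X true) = SW τ W x * X true
  | [], _ => rfl
  | a :: W, x => by rw [SW_cons, SW_cons, SW_mul_X_true W x, sI_mul_X_true]

/-- **Iterated Leibniz for `D_W`**: `D_W(xy) = Σ_{(U,V) deshuffle of W} D_U(x) D_V(y)`.
[folklore] -/
theorem DW_mul : ∀ (W : List ℕ) (x y : WordSeries Bool B),
    DW τ W (x * y) = ((desh W).map fun de => DW τ de.1 x * DW τ de.2 y).sum
  | [], x, y => by simp [desh]
  | a :: W, x, y => by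
    rw [DW_cons, DW_mul W x y, ← derivIHom_apply, map_list_sum, List.map_map, desh, List.map_append,
      List.sum_append, List.map_map, List.map_map]
    have h : (desh W).map (⇑(derivIHom (τ a)) ∘ fun de => DW τ de.1 x * DW τ de.2 y) =
        (desh W).map fun de =>
          derivI (τ a) (DW τ de.1 x) * DW τ de.2 y + DW τ de.1 x * derivI (τ a) (DW τ de.2 y) :=
      List.map_congr_left fun de _ => derivI_mul (τ a) _ _
    rw [h, List.sum_map_add]
    rfl

/-- **Iterated twisted Leibniz for `s_W`**: `s_W(xy) = Σ_{(U,V) deshuffle of W} D_U(x) s_V(y)`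
(the monomial `F_W` acts on a product through its deshuffle coproduct). [folklore] -/
theorem SW_mul : ∀ (W : List ℕ) (x y : WordSeries Bool B),
    SW τ W (x * y) = ((desh W).map fun de => DW τ de.1 x * SW τ de.2 y).sum
  | [], x, y => by simp [desh]
  | a :: W, x, y => by
    rw [SW_cons, SW_mul W x y, ← sIHom_apply, map_list_sum, List.map_map, desh, List.map_append,
      List.sum_append, List.map_map, List.map_map]
    have h : (desh W).map (⇑(sIHom (τ a)) ∘ fun de => DW τ de.1 x * SW τ de.2 y) =
        (desh W).map fun de =>
          derivI (τ a) (DW τ de.1 x) * SW τ de.2 y + DW τ de.1 x * sI (τ a) (SW τ de.2 y) :=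
      List.map_congr_left fun de _ => sI_mul (τ a) _ _
    rw [h, List.sum_map_add]
    rfl

/-- `P_W · e₁`: `s_W(e₁) = P_W e₁`. [folklore] -/
theorem SW_X_true (W : List ℕ) : SW τ W (X true : WordSeries Bool B) = PW τ W * X true := by
  rw [PW, ← SW_mul_X_true, one_mul]

end Iterates

/-! ## Weights (homogeneity) -/

section Weight

omit [DecidableEq S]

/-- `x` is homogeneous of weight `n`: supported on words of length `n`. [folklore] -/
def IsWt (x : WordSeries S B) (n : ℕ) : Prop := ∀ w, x w ≠ 0 → w.length = n

/-- A homogeneous series vanishes off its weight. [folklore] -/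
theorem IsWt.apply_eq_zero {x : WordSeries S B} {n : ℕ} (h : IsWt x n) {w : List S}
    (hw : w.length ≠ n) : x w = 0 :=
  by_contra fun h' => hw (h w h')

/-- Transport of a weight along an equality of naturals. [folklore] -/
theorem IsWt.of_eq {x : WordSeries S B} {n n' : ℕ} (h : IsWt x n) (e : n = n') : IsWt x n' :=
  e ▸ h

/-- `0` has every weight. [folklore] -/
theorem isWt_zero (n : ℕ) : IsWt (0 : WordSeries S B) n := fun _ h => absurd rfl h

/-- `1` has weight `0`. [folklore] -/
theorem isWt_one : IsWt (1 : WordSeries S B) 0 := fun w h => by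
  cases w with
  | nil => rfl
  | cons s w => exact absurd (one_cons s w) h

/-- Constants have weight `0`. [folklore] -/
theorem isWt_C (r : B) : IsWt (C r : WordSeries S B) 0 := fun w h => by
  cases w with
  | nil => rfl
  | cons s w => exact absurd (C_cons r s w) h

/-- Sums of homogeneous series of the same weight. [folklore] -/
theorem IsWt.add {x y : WordSeries S B} {n : ℕ} (hx : IsWt x n) (hy : IsWt y n) : IsWt (x + y) n :=
  fun w h => by
    by_cases h1 : x w = 0
    · rw [WordSeries.add_apply, h1, zero_add] at h
      exact hy w h
    · exact hx w h1

/-- Negation preserves weights. [folklore] -/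
theorem IsWt.neg {x : WordSeries S B} {n : ℕ} (hx : IsWt x n) : IsWt (-x) n :=
  fun w h => hx w fun h' => h (by rw [WordSeries.neg_apply, h', neg_zero])

/-- Differences of homogeneous series of the same weight. [folklore] -/
theorem IsWt.sub {x y : WordSeries S B} {n : ℕ} (hx : IsWt x n) (hy : IsWt y n) : IsWt (x - y) n := by
  rw [sub_eq_add_neg]; exact hx.add hy.neg

/-- **Weights add under the Cauchy product.** [folklore] -/
theorem IsWt.mul {x y : WordSeries S B} {m n : ℕ} (hx : IsWt x m) (hy : IsWt y n) :
    IsWt (x * y) (m + n) := fun w h => by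
  obtain ⟨k, h1, h2⟩ := exists_take_drop_ne_zero h
  have hl := congrArg List.length (List.take_append_drop k w)
  rw [List.length_append, hx _ h1, hy _ h2] at hl
  exact hl.symm

/-- List sums of homogeneous series of the same weight. [folklore] -/
theorem IsWt.list_sum {L : List (WordSeries S B)} {n : ℕ} (h : ∀ x ∈ L, IsWt x n) : IsWt L.sum n := by
  induction L with
  | nil => exact isWt_zero n
  | cons x L ih =>
    rw [List.sum_cons]
    exact (h x List.mem_cons_self).add (ih fun y hy => h y (List.mem_cons_of_mem x hy))

variable [DecidableEq S]

/-- Letters have weight `1`. [folklore] -/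
theorem isWt_X (k : S) : IsWt (X k : WordSeries S B) 1 := fun w h => by
  rw [eq_of_X_apply_ne_zero h]; rfl

/-- Word monomials have weight their length. [folklore] -/
theorem isWt_wordX (c : List S) : IsWt (wordX c : WordSeries S B) c.length := fun w h => by
  rw [eq_of_wordX_apply_ne_zero h]

/-- Contraction against a family raising the weight by `p` raises the weight by `p`. [folklore] -/
theorem IsWt.contr {x : WordSeries S B} {m : ℕ} (hx : IsWt x m) {Ω : List S → WordSeries S B} {p : ℕ}
    (hΩ : ∀ c, IsWt (Ω c) (c.length + p)) : IsWt (contr x Ω) (m + p) := fun w h => by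
  rw [contr_apply] at h
  obtain ⟨c, -, hc⟩ := Finset.exists_ne_zero_of_sum_ne_zero h
  have h1 := hx c (left_ne_zero_of_mul hc)
  have h2 := hΩ c w (right_ne_zero_of_mul hc)
  omega

/-- The kernel of a derivation raising the weight of letters by `p` raises weights by `p`.
[folklore] -/
theorem isWt_dWord {θ : S → WordSeries S B} {p : ℕ} (hθ : ∀ k, IsWt (θ k) (p + 1)) :
    ∀ c : List S, IsWt (dWord θ c) (c.length + p)
  | [] => isWt_zero _
  | k :: c => by
    rw [dWord_cons, List.length_cons]
    exact (((hθ k).mul (isWt_wordX c)).of_eq (by omega)).add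
      (((isWt_X k).mul (isWt_dWord hθ c)).of_eq (by omega))

/-- A derivation raising the weight of letters by `p` raises weights by `p`. [folklore] -/
theorem IsWt.derivW {x : WordSeries S B} {m : ℕ} (hx : IsWt x m) {θ : S → WordSeries S B} {p : ℕ}
    (hθ : ∀ k, IsWt (θ k) (p + 1)) : IsWt (derivW θ x) (m + p) :=
  hx.contr (isWt_dWord hθ)

/-- Ihara's derivation of a weight-`a` element raises the weight of letters by `a`. [folklore] -/
theorem isWt_θIhara {ψ : WordSeries Bool B} {a : ℕ} (hψ : IsWt ψ a) : ∀ k, IsWt (θIhara ψ k) (a + 1)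
  | true => (hψ.mul (isWt_X true)).sub (((isWt_X true).mul hψ).of_eq (add_comm _ _))
  | false => isWt_zero _

/-- `D_ψ` raises weights by the weight of `ψ`. [folklore] -/
theorem IsWt.derivI {x : WordSeries Bool B} {m : ℕ} (hx : IsWt x m) {ψ : WordSeries Bool B} {a : ℕ}
    (hψ : IsWt ψ a) : IsWt (derivI ψ x) (m + a) :=
  hx.derivW (isWt_θIhara hψ)

/-- `s_ψ` raises weights by the weight of `ψ`. [folklore] -/
theorem IsWt.sI {x : WordSeries Bool B} {m : ℕ} (hx : IsWt x m) {ψ : WordSeries Bool B} {a : ℕ}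
    (hψ : IsWt ψ a) : IsWt (sI ψ x) (m + a) :=
  (hx.mul hψ).add (hx.derivI hψ)

variable {τ : ℕ → WordSeries Bool B}

/-- For homogeneous generators (`τ a` of weight `a`), `D_W` raises weights by `|W| = Σ aᵢ`.
[folklore] -/
theorem IsWt.DW (hτ : ∀ a, IsWt (τ a) a) : ∀ (W : List ℕ) {x : WordSeries Bool B} {m : ℕ},
    IsWt x m → IsWt (DW τ W x) (m + W.sum)
  | [], _, _, hx => hx
  | a :: W, _, _, hx => by
    rw [DW_cons, List.sum_cons]
    exact ((IsWt.DW hτ W hx).derivI (hτ a)).of_eq (by omega)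

/-- For homogeneous generators, `s_W` raises weights by `|W|`. [folklore] -/
theorem IsWt.SW (hτ : ∀ a, IsWt (τ a) a) : ∀ (W : List ℕ) {x : WordSeries Bool B} {m : ℕ},
    IsWt x m → IsWt (SW τ W x) (m + W.sum)
  | [], _, _, hx => hx
  | a :: W, _, _, hx => by
    rw [SW_cons, List.sum_cons]
    exact ((IsWt.SW hτ W hx).sI (hτ a)).of_eq (by omega)

/-- For homogeneous generators, `P_W` is homogeneous of weight `|W|`. [folklore] -/
theorem isWt_PW (hτ : ∀ a, IsWt (τ a) a) (W : List ℕ) : IsWt (PW τ W) W.sum :=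
  (isWt_one.SW hτ W).of_eq (zero_add _)

/-- The kernel of the zero derivation vanishes. [folklore] -/
theorem dWord_eq_zero_of_forall {θ : S → WordSeries S B} (hθ : ∀ k, θ k = 0) :
    ∀ c : List S, dWord θ c = 0
  | [] => rfl
  | k :: c => by rw [dWord_cons, hθ, dWord_eq_zero_of_forall hθ c, zero_mul, mul_zero, add_zero]

/-- `s_0 = 0`. [folklore] -/
theorem sI_zero_gen (x : WordSeries Bool B) : sI 0 x = 0 := by
  have hθ : ∀ k, θIhara (0 : WordSeries Bool B) k = 0 := fun k => by
    cases k
    · rfl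
    · rw [θIhara_true, zero_mul, mul_zero, sub_zero]
  rw [sI, mul_zero, zero_add, derivI, derivW]
  ext w
  rw [contr_apply, WordSeries.zero_apply]
  exact Finset.sum_eq_zero fun c _ => by rw [dWord_eq_zero_of_forall hθ c, WordSeries.zero_apply, mul_zero]

/-- `s_W = 0` as soon as one generator `τ a`, `a ∈ W`, vanishes. [folklore] -/
theorem SW_eq_zero_of_mem {a : ℕ} (ha : τ a = 0) : ∀ {W : List ℕ}, a ∈ W →
    ∀ x : WordSeries Bool B, SW τ W x = 0
  | [], h, _ => absurd h List.not_mem_nil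
  | b :: W, h, x => by
    rw [SW_cons]
    rcases List.mem_cons.1 h with rfl | h
    · rw [ha, sI_zero_gen]
    · rw [SW_eq_zero_of_mem ha h x, sI_zero]

/-- `P_W = 0` as soon as one generator `τ a`, `a ∈ W`, vanishes. [folklore] -/
theorem PW_eq_zero_of_mem {a : ℕ} (ha : τ a = 0) {W : List ℕ} (h : a ∈ W) : PW τ W = 0 :=
  SW_eq_zero_of_mem ha h 1

end Weight

/-! ## Locality: operators reading only the coefficients of subwords -/

section Local

/-- `T` is **local**: `(T x)(w)` is the finite combination `Σ_{c ⊑ w} x(c) (T X_c)(w)` of the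
coefficients of `x` on subwords of `w` (so `T` is determined by its values on word monomials and
commutes with infinite sums). [folklore] -/
def IsLocal (T : WordSeries S B → WordSeries S B) : Prop :=
  ∀ (x : WordSeries S B) (w : List S), T x w = ∑ c ∈ subwords w, x c * T (wordX c) w

/-- The identity is local (`contr_wordX`). [folklore] -/
theorem isLocal_id : IsLocal (fun x : WordSeries S B => x) := fun x w => by
  have h := congrFun (contr_wordX (B := B) x) w
  rw [contr_apply] at h
  exact h.symm

/-- Contraction against a triangular family is local. [folklore] -/
theorem isLocal_contr {Ω : List S → WordSeries S B} (hΩ : ∀ c w, Ω c w ≠ 0 → List.Sublist c w) :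
    IsLocal fun x => contr x Ω := fun x w => by
  dsimp only
  simp_rw [contr_wordX_left _ hΩ]
  rfl

/-- Right multiplication by a fixed series is local. [folklore] -/
theorem isLocal_mul_right (ψ : WordSeries S B) : IsLocal fun x => x * ψ := fun x w => by
  dsimp only
  have h : ∀ c ∈ subwords w, x c * (wordX c * ψ : WordSeries S B) w =
      ∑ k ∈ Finset.range (w.length + 1), if w.take k = c then x c * ψ (w.drop k) else 0 := by
    intro c _
    rw [mul_apply, Finset.mul_sum]
    refine Finset.sum_congr rfl fun k _ => ?_
    rw [wordX_apply]
    split_ifs <;> simp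
  rw [Finset.sum_congr rfl h, Finset.sum_comm, mul_apply]
  refine Finset.sum_congr rfl fun k _ => ?_
  rw [Finset.sum_ite_eq, if_pos (mem_subwords.2 (List.take_sublist k w))]

/-- Sums of local operators are local. [folklore] -/
theorem IsLocal.add {T T' : WordSeries S B → WordSeries S B} (hT : IsLocal T) (hT' : IsLocal T') :
    IsLocal fun x => T x + T' x := fun x w => by
  dsimp only
  rw [WordSeries.add_apply, hT x w, hT' x w, ← Finset.sum_add_distrib]
  refine Finset.sum_congr rfl fun c _ => ?_
  rw [WordSeries.add_apply, mul_add]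

/-- A local operator is triangular on word monomials. [folklore] -/
theorem IsLocal.apply_wordX_eq_zero {T : WordSeries S B → WordSeries S B} (hT : IsLocal T)
    {d c : List S} (h : ¬List.Sublist d c) : T (wordX d) c = 0 := by
  rw [hT (wordX d) c]
  refine Finset.sum_eq_zero fun c' hc' => ?_
  rw [wordX_apply, if_neg, zero_mul]
  rintro rfl
  exact h (mem_subwords.1 hc')

/-- **Composites of local operators are local.** [folklore] -/
theorem IsLocal.comp {T T' : WordSeries S B → WordSeries S B} (hT : IsLocal T) (hT' : IsLocal T') :
    IsLocal fun x => T (T' x) := fun x w => by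
  dsimp only
  rw [hT (T' x) w]
  have h1 : ∀ c ∈ subwords w, T' x c * T (wordX c) w =
      ∑ d ∈ subwords w, x d * (T' (wordX d) c * T (wordX c) w) := by
    intro c hc
    rw [hT' x c, Finset.sum_mul]
    have h2 : ∑ d ∈ subwords c, x d * T' (wordX d) c * T (wordX c) w =
        ∑ d ∈ subwords w, x d * T' (wordX d) c * T (wordX c) w :=
      Finset.sum_subset (subwords_mono (mem_subwords.1 hc)) fun d _ hd => by
        rw [hT'.apply_wordX_eq_zero fun h => hd (mem_subwords.2 h), mul_zero, zero_mul]
    rw [h2]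
    exact Finset.sum_congr rfl fun d _ => mul_assoc _ _ _
  rw [Finset.sum_congr rfl h1, Finset.sum_comm]
  refine Finset.sum_congr rfl fun d _ => ?_
  rw [← Finset.mul_sum, hT (T' (wordX d)) w]

/-- `D_θ` is local. [folklore] -/
theorem isLocal_derivW {θ : S → WordSeries S B} (hθ : ∀ k w, θ k w ≠ 0 → List.Sublist [k] w) :
    IsLocal (derivW θ) :=
  isLocal_contr (dWord_apply_ne_zero θ hθ)

/-- `s_ψ` is local. [folklore] -/
theorem isLocal_sI (ψ : WordSeries Bool B) : IsLocal (sI ψ) :=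
  (isLocal_mul_right ψ).add (isLocal_derivW (θIhara_apply_ne_zero ψ))

/-- `D_ψ` is local. [folklore] -/
theorem isLocal_derivI (ψ : WordSeries Bool B) : IsLocal (derivI ψ) :=
  isLocal_derivW (θIhara_apply_ne_zero ψ)

/-- **`s_W` is local**: `s_W(x)(w) = Σ_{c ⊑ w} x(c) · s_W(X_c)(w)`. [folklore] -/
theorem isLocal_SW (τ : ℕ → WordSeries Bool B) : ∀ W : List ℕ, IsLocal (SW τ W)
  | [] => isLocal_id
  | a :: W => (isLocal_sI (τ a)).comp (isLocal_SW τ W)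

/-- `D_W` is local. [folklore] -/
theorem isLocal_DW (τ : ℕ → WordSeries Bool B) : ∀ W : List ℕ, IsLocal (DW τ W)
  | [] => isLocal_id
  | a :: W => (isLocal_derivI (τ a)).comp (isLocal_DW τ W)

end Local

/-! ## Two-variable series: slices, lifted operators, and the coderivation property -/

section TwoVar

omit [DecidableEq S]

/-- The slice `u ↦ Z(u, v)` of a two-variable series at the inner index `v`. [folklore] -/
def slice (Z : WordSeries S (WordSeries S B)) (v : List S) : WordSeries S B := fun u => Z u v

omit [CommRing B] in
/-- Coefficients of a slice. [folklore] -/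
@[simp] theorem slice_apply (Z : WordSeries S (WordSeries S B)) (v u : List S) : slice Z v u = Z u v :=
  rfl

/-- Slices are additive. [folklore] -/
theorem slice_add (Z Z' : WordSeries S (WordSeries S B)) (v : List S) :
    slice (Z + Z') v = slice Z v + slice Z' v := rfl

/-- **Slices of a product**: `(Z Z')(·, v) = Σ_{v = v₁ v₂} Z(·, v₁) Z'(·, v₂)`. [folklore] -/
theorem slice_mul (Z Z' : WordSeries S (WordSeries S B)) (v : List S) :
    slice (Z * Z') v =
      ∑ j ∈ Finset.range (v.length + 1), slice Z (v.take j) * slice Z' (v.drop j) := by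
  ext u
  rw [slice_apply, mul_apply, finset_sum_apply, finset_sum_apply]
  simp_rw [mul_apply, slice_apply]
  exact Finset.sum_comm

/-- The slice of `f ⊗ g` at `v` is `g(v)·f`. [folklore] -/
theorem slice_tensor (f g : WordSeries S B) (v : List S) : slice (tensor f g) v = C (g v) * f := by
  ext u
  rw [slice_apply, tensor_apply, C_mul_apply, mul_comm]

/-- The slices of `1` are the constants `1(v)`. [folklore] -/
theorem slice_one (v : List S) :
    slice (1 : WordSeries S (WordSeries S B)) v = C ((1 : WordSeries S B) v) := by
  ext u
  cases u <;> rfl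

/-- `r ⊗ 1` is the constant `r` of `B⟨⟨S⟩⟩ ⊗̂ B⟨⟨S⟩⟩`. [folklore] -/
theorem tensor_C_one (r : B) : tensor (C r) (1 : WordSeries S B) = C (C r) := by
  refine WordSeries.ext fun u => WordSeries.ext fun v => ?_
  rw [tensor_apply]
  cases u with
  | nil =>
    rw [C_nil, C_nil]
    cases v with
    | nil => rw [one_nil, C_nil, mul_one]
    | cons s v => rw [one_cons, C_cons, mul_zero]
  | cons s u => rw [C_cons, C_cons, zero_mul]; rfl

/-- `f ⊗ 0 = 0`. [folklore] -/
@[simp] theorem tensor_zero_right (f : WordSeries S B) : tensor f (0 : WordSeries S B) = 0 := by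
  refine WordSeries.ext fun u => WordSeries.ext fun v => ?_
  rw [tensor_apply, WordSeries.zero_apply, mul_zero]; rfl

/-- `0 ⊗ g = 0`. [folklore] -/
@[simp] theorem tensor_zero_left (g : WordSeries S B) : tensor (0 : WordSeries S B) g = 0 := by
  refine WordSeries.ext fun u => WordSeries.ext fun v => ?_
  rw [tensor_apply, WordSeries.zero_apply, zero_mul]; rfl

/-- `⊗` is subtractive on the left. [folklore] -/
theorem tensor_sub_left (f f' g : WordSeries S B) : tensor (f - f') g = tensor f g - tensor f' g := by
  refine WordSeries.ext fun u => WordSeries.ext fun v => ?_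
  simp [sub_mul]

/-- `⊗` is subtractive on the right. [folklore] -/
theorem tensor_sub_right (f g g' : WordSeries S B) : tensor f (g - g') = tensor f g - tensor f g' := by
  refine WordSeries.ext fun u => WordSeries.ext fun v => ?_
  simp [mul_sub]

/-- `δ` of a constant is that constant: `δ r = r ⊗ 1`. [folklore] -/
theorem delta_C (r : B) : delta (C r : WordSeries S B) = C (C r) := by
  rw [← tensor_C_one]
  refine WordSeries.ext fun u => WordSeries.ext fun v => ?_
  rw [delta_apply, tensor_apply]
  cases u with
  | nil =>
    rw [MZV.shuffleWord_nil_left, List.map_singleton, List.sum_singleton, C_nil]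
    cases v with
    | nil => rw [C_nil, one_nil, mul_one]
    | cons s v => rw [C_cons, one_cons, mul_zero]
  | cons s u =>
    rw [C_cons, zero_mul]
    refine List.sum_eq_zero fun x hx => ?_
    obtain ⟨w, hw, rfl⟩ := List.mem_map.mp hx
    have hlen := MZV.length_of_mem_shuffleWord _ _ hw
    cases w with
    | nil => simp only [List.length_nil, List.length_cons] at hlen; omega
    | cons t w => rfl

/-- `δ` is subtractive. [folklore] -/
theorem delta_sub (f g : WordSeries S B) : delta (f - g) = delta f - delta g :=
  (deltaHom (S := S) (B := B)).map_sub f g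

variable (T : WordSeries S B →+ WordSeries S B)

/-- `T ⊗ id` on two-variable series: `T` acting on the outer variable. [folklore] -/
def mapOuter (Z : WordSeries S (WordSeries S B)) : WordSeries S (WordSeries S B) :=
  fun u v => T (slice Z v) u

/-- `id ⊗ T` on two-variable series: `T` acting on the inner variable. [folklore] -/
def mapInner (Z : WordSeries S (WordSeries S B)) : WordSeries S (WordSeries S B) := fun u => T (Z u)

/-- Coefficients of `mapOuter`. [folklore] -/
@[simp] theorem mapOuter_apply (Z : WordSeries S (WordSeries S B)) (u v : List S) :
    mapOuter T Z u v = T (slice Z v) u := rfl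

/-- Coefficients of `mapInner`. [folklore] -/
@[simp] theorem mapInner_apply (Z : WordSeries S (WordSeries S B)) (u : List S) :
    mapInner T Z u = T (Z u) := rfl

/-- Slices of `mapOuter`. [folklore] -/
theorem slice_mapOuter (Z : WordSeries S (WordSeries S B)) (v : List S) :
    slice (mapOuter T Z) v = T (slice Z v) := rfl

/-- `mapOuter T` is additive. [folklore] -/
theorem mapOuter_add (Z Z' : WordSeries S (WordSeries S B)) :
    mapOuter T (Z + Z') = mapOuter T Z + mapOuter T Z' := by
  refine WordSeries.ext fun u => WordSeries.ext fun v => ?_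
  rw [mapOuter_apply, slice_add, map_add]; rfl

/-- `mapInner T` is additive. [folklore] -/
theorem mapInner_add (Z Z' : WordSeries S (WordSeries S B)) :
    mapInner T (Z + Z') = mapInner T Z + mapInner T Z' := by
  refine WordSeries.ext fun u => ?_
  rw [mapInner_apply, WordSeries.add_apply, map_add]; rfl

/-- `mapOuter T 0 = 0`. [folklore] -/
@[simp] theorem mapOuter_zero : mapOuter T (0 : WordSeries S (WordSeries S B)) = 0 := by
  refine WordSeries.ext fun u => WordSeries.ext fun v => ?_
  rw [mapOuter_apply, show slice (0 : WordSeries S (WordSeries S B)) v = 0 from rfl, map_zero]; rfl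

/-- `mapInner T 0 = 0`. [folklore] -/
@[simp] theorem mapInner_zero : mapInner T (0 : WordSeries S (WordSeries S B)) = 0 := by
  refine WordSeries.ext fun u => ?_
  rw [mapInner_apply, WordSeries.zero_apply, map_zero]

/-- `mapOuter T` as an additive map. [folklore] -/
def mapOuterHom : WordSeries S (WordSeries S B) →+ WordSeries S (WordSeries S B) where
  toFun := mapOuter T
  map_zero' := mapOuter_zero T
  map_add' := mapOuter_add T

/-- `mapOuterHom T Z = mapOuter T Z`. [folklore] -/
@[simp] theorem mapOuterHom_apply (Z : WordSeries S (WordSeries S B)) : mapOuterHom T Z = mapOuter T Z :=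
  rfl

/-- `mapInner T` as an additive map. [folklore] -/
def mapInnerHom : WordSeries S (WordSeries S B) →+ WordSeries S (WordSeries S B) where
  toFun := mapInner T
  map_zero' := mapInner_zero T
  map_add' := mapInner_add T

/-- `mapInnerHom T Z = mapInner T Z`. [folklore] -/
@[simp] theorem mapInnerHom_apply (Z : WordSeries S (WordSeries S B)) : mapInnerHom T Z = mapInner T Z :=
  rfl

variable {T}

/-- `(T ⊗ id)(f ⊗ g) = Tf ⊗ g` for a `B`-linear `T`. [folklore] -/
theorem mapOuter_tensor (hC : ∀ (r : B) (x : WordSeries S B), T (C r * x) = C r * T x)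
    (f g : WordSeries S B) : mapOuter T (tensor f g) = tensor (T f) g := by
  refine WordSeries.ext fun u => WordSeries.ext fun v => ?_
  rw [mapOuter_apply, slice_tensor, hC, C_mul_apply, tensor_apply, mul_comm]

/-- `(id ⊗ T)(f ⊗ g) = f ⊗ Tg` for a `B`-linear `T`. [folklore] -/
theorem mapInner_tensor (hC : ∀ (r : B) (x : WordSeries S B), T (C r * x) = C r * T x)
    (f g : WordSeries S B) : mapInner T (tensor f g) = tensor f (T g) := by
  refine WordSeries.ext fun u => WordSeries.ext fun v => ?_
  have h : tensor f g u = C (f u) * g := WordSeries.ext fun v => by rw [tensor_apply, C_mul_apply]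
  rw [mapInner_apply, h, hC, C_mul_apply, tensor_apply]

/-- `(T ⊗ id)(r·Z) = r·(T ⊗ id)(Z)` for a `B`-linear `T`. [folklore] -/
theorem mapOuter_CC_mul (hC : ∀ (r : B) (x : WordSeries S B), T (C r * x) = C r * T x) (r : B)
    (Z : WordSeries S (WordSeries S B)) : mapOuter T (C (C r) * Z) = C (C r) * mapOuter T Z := by
  refine WordSeries.ext fun u => WordSeries.ext fun v => ?_
  have h : slice (C (C r) * Z) v = C r * slice Z v := WordSeries.ext fun u' => by
    rw [slice_apply, C_mul_apply, C_mul_apply, C_mul_apply, slice_apply]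
  rw [mapOuter_apply, h, hC, C_mul_apply, C_mul_apply, C_mul_apply, mapOuter_apply]

/-- `(id ⊗ T)(r·Z) = r·(id ⊗ T)(Z)` for a `B`-linear `T`. [folklore] -/
theorem mapInner_CC_mul (hC : ∀ (r : B) (x : WordSeries S B), T (C r * x) = C r * T x) (r : B)
    (Z : WordSeries S (WordSeries S B)) : mapInner T (C (C r) * Z) = C (C r) * mapInner T Z := by
  refine WordSeries.ext fun u => ?_
  rw [mapInner_apply, C_mul_apply, hC, C_mul_apply, mapInner_apply]

/-- **`id ⊗ T` satisfies the (twisted) Leibniz rule of `T`**: if `T(xy) = D(x) y + x T(y)` then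
`(id ⊗ T)(Z Z') = (id ⊗ D)(Z) Z' + Z (id ⊗ T)(Z')`. [folklore] -/
theorem mapInner_mul {D : WordSeries S B →+ WordSeries S B}
    (hL : ∀ x y : WordSeries S B, T (x * y) = D x * y + x * T y)
    (Z Z' : WordSeries S (WordSeries S B)) :
    mapInner T (Z * Z') = mapInner D Z * Z' + Z * mapInner T Z' := by
  refine WordSeries.ext fun u => ?_
  rw [mapInner_apply, mul_apply, map_sum, WordSeries.add_apply, mul_apply, mul_apply,
    ← Finset.sum_add_distrib]
  refine Finset.sum_congr rfl fun k _ => ?_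
  rw [hL, mapInner_apply, mapInner_apply]

/-- **`T ⊗ id` satisfies the (twisted) Leibniz rule of `T`**: if `T(xy) = D(x) y + x T(y)` then
`(T ⊗ id)(Z Z') = (D ⊗ id)(Z) Z' + Z (T ⊗ id)(Z')`. [folklore] -/
theorem mapOuter_mul {D : WordSeries S B →+ WordSeries S B}
    (hL : ∀ x y : WordSeries S B, T (x * y) = D x * y + x * T y)
    (Z Z' : WordSeries S (WordSeries S B)) :
    mapOuter T (Z * Z') = mapOuter D Z * Z' + Z * mapOuter T Z' := by
  refine WordSeries.ext fun u => WordSeries.ext fun v => ?_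
  have h : T (slice (Z * Z') v) = slice (mapOuter D Z * Z') v + slice (Z * mapOuter T Z') v := by
    rw [slice_mul, map_sum, slice_mul, slice_mul, ← Finset.sum_add_distrib]
    refine Finset.sum_congr rfl fun j _ => ?_
    rw [hL, slice_mapOuter, slice_mapOuter]
  rw [mapOuter_apply, h]; rfl

/-- The slices `u₂ ↦ (ψ ⊗ 1)(u₂)` are the constants `ψ(u₂)`. [folklore] -/
theorem tensor_one_apply (ψ : WordSeries S B) (u : List S) : tensor ψ 1 u = C (ψ u) :=
  WordSeries.ext fun v => by
    rw [tensor_apply]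
    cases v with
    | nil => rw [one_nil, C_nil, mul_one]
    | cons s v => rw [one_cons, C_cons, mul_zero]

/-- The slices `u₂ ↦ (1 ⊗ ψ)(u₂)` are `ψ` at `u₂ = ∅` and `0` otherwise. [folklore] -/
theorem one_tensor_apply (ψ : WordSeries S B) (u : List S) :
    tensor 1 ψ u = C ((1 : WordSeries S B) u) * ψ :=
  WordSeries.ext fun v => by rw [tensor_apply, C_mul_apply]

/-- **`Z · (ψ ⊗ 1) = (R_ψ ⊗ id)(Z)`** (right multiplication by `ψ` in the outer variable).
[folklore] -/
theorem mul_tensor_one (ψ : WordSeries S B) (Z : WordSeries S (WordSeries S B)) :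
    Z * tensor ψ 1 = mapOuter (AddMonoidHom.mulRight ψ) Z := by
  refine WordSeries.ext fun u => WordSeries.ext fun v => ?_
  rw [mapOuter_apply, AddMonoidHom.mulRight_apply, mul_apply, finset_sum_apply, mul_apply]
  refine Finset.sum_congr rfl fun k _ => ?_
  rw [tensor_one_apply, mul_C_comm, C_mul_apply, slice_apply, mul_comm]

/-- **`Z · (1 ⊗ ψ) = (id ⊗ R_ψ)(Z)`** (right multiplication by `ψ` in the inner variable).
[folklore] -/
theorem mul_one_tensor (ψ : WordSeries S B) (Z : WordSeries S (WordSeries S B)) :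
    Z * tensor 1 ψ = mapInner (AddMonoidHom.mulRight ψ) Z := by
  refine WordSeries.ext fun u => ?_
  rw [mapInner_apply, AddMonoidHom.mulRight_apply, mul_apply,
    Finset.sum_eq_single_of_mem u.length (Finset.mem_range.2 (Nat.lt_succ_self _))
      fun k hk hne => ?_]
  · rw [List.take_length, List.drop_length, one_tensor_apply, one_nil]
    change Z u * (C (1 : B) * ψ) = Z u * ψ
    rw [show (C (1 : B) : WordSeries S B) = 1 from rfl, one_mul]
  · have hk' : k < u.length := lt_of_le_of_ne (Nat.lt_succ_iff.1 (Finset.mem_range.1 hk)) hne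
    have hne' : u.drop k ≠ [] := by rw [Ne, List.drop_eq_nil_iff]; omega
    obtain ⟨s, u', hsu⟩ := List.exists_cons_of_ne_nil hne'
    rw [one_tensor_apply, hsu, one_cons]
    change Z (u.take k) * (C (0 : B) * ψ) = 0
    rw [show (C (0 : B) : WordSeries S B) = 0 from by ext w; cases w <;> rfl, zero_mul, mul_zero]

/-- **Coderivation property of right multiplication by a primitive element**:
`δ(x ψ) = (R_ψ ⊗ id + id ⊗ R_ψ)(δ x)` when `δψ = ψ ⊗ 1 + 1 ⊗ ψ`. [folklore] -/
theorem delta_mul_of_prim {ψ : WordSeries S B} (hψ : delta ψ = tensor ψ 1 + tensor 1 ψ)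
    (x : WordSeries S B) :
    delta (x * ψ) = mapOuter (AddMonoidHom.mulRight ψ) (delta x) +
      mapInner (AddMonoidHom.mulRight ψ) (delta x) := by
  rw [delta_mul, hψ, mul_add, mul_tensor_one, mul_one_tensor]

end TwoVar

section CoDeriv

omit [DecidableEq S] in
/-- `δ` of a finite sum. [folklore] -/
theorem delta_sum {ι : Type*} (s : Finset ι) (f : ι → WordSeries S B) :
    delta (∑ i ∈ s, f i) = ∑ i ∈ s, delta (f i) :=
  map_sum (deltaHom (S := S) (B := B)) f s

/-- `s_ψ` of a finite sum. [folklore] -/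
theorem sI_sum {ι : Type*} (ψ : WordSeries Bool B) (s : Finset ι) (f : ι → WordSeries Bool B) :
    sI ψ (∑ i ∈ s, f i) = ∑ i ∈ s, sI ψ (f i) :=
  map_sum (sIHom ψ) f s

omit [DecidableEq S] in
/-- `mapOuter T` of a finite sum. [folklore] -/
theorem mapOuter_sum {ι : Type*} (T : WordSeries S B →+ WordSeries S B) (s : Finset ι)
    (Z : ι → WordSeries S (WordSeries S B)) :
    mapOuter T (∑ i ∈ s, Z i) = ∑ i ∈ s, mapOuter T (Z i) :=
  map_sum (mapOuterHom T) Z s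

omit [DecidableEq S] in
/-- `mapInner T` of a finite sum. [folklore] -/
theorem mapInner_sum {ι : Type*} (T : WordSeries S B →+ WordSeries S B) (s : Finset ι)
    (Z : ι → WordSeries S (WordSeries S B)) :
    mapInner T (∑ i ∈ s, Z i) = ∑ i ∈ s, mapInner T (Z i) :=
  map_sum (mapInnerHom T) Z s

/-- **Coderivation property of a derivation with primitive values on letters**, on word
monomials: `δ(D X_c) = (D ⊗ id + id ⊗ D)(δ X_c)`. [folklore] -/
theorem delta_deriv_wordX {D : WordSeries S B →+ WordSeries S B}
    (hL : ∀ x y : WordSeries S B, D (x * y) = D x * y + x * D y)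
    (hC : ∀ (r : B) (x : WordSeries S B), D (C r * x) = C r * D x)
    (hX : ∀ k : S, delta (D (X k)) = tensor (D (X k)) 1 + tensor 1 (D (X k))) :
    ∀ c : List S, delta (D (wordX c)) = mapOuter D (delta (wordX c)) + mapInner D (delta (wordX c)) := by
  have h1 : D 1 = 0 := by
    have h := hL 1 1
    rw [mul_one, one_mul, mul_one] at h
    have h2 : D 1 + D 1 = D 1 + 0 := by rw [add_zero]; exact h.symm
    exact add_left_cancel h2
  have hCr : ∀ r : B, D (C r) = 0 := fun r => by rw [← mul_one (C r), hC, h1, mul_zero]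
  have hI1 : mapInner D (1 : WordSeries S (WordSeries S B)) = 0 := by
    refine WordSeries.ext fun u => ?_
    rw [mapInner_apply]
    cases u with
    | nil => exact h1
    | cons s u => exact map_zero D
  have hO1 : mapOuter D (1 : WordSeries S (WordSeries S B)) = 0 := by
    refine WordSeries.ext fun u => WordSeries.ext fun v => ?_
    rw [mapOuter_apply, slice_one, hCr]; rfl
  have hgen : ∀ k : S, delta (D (X k)) = mapOuter D (delta (X k)) + mapInner D (delta (X k)) := by
    intro k
    rw [delta_X, mapOuter_add, mapInner_add, mapOuter_tensor hC, mapOuter_tensor hC,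
      mapInner_tensor hC, mapInner_tensor hC, h1, tensor_zero_left, tensor_zero_right, add_zero,
      zero_add, hX]
  intro c
  induction c with
  | nil => rw [wordX_nil, h1, delta_zero, delta_one, hO1, hI1, add_zero]
  | cons k c ih =>
    rw [wordX_cons, hL, delta_add, delta_mul, delta_mul, hgen, ih, delta_mul,
      mapOuter_mul hL, mapInner_mul hL]
    simp only [add_mul, mul_add]
    abel

/-- Ihara's derivation of a primitive element has primitive values on letters:
`δ(ψ e₁ - e₁ ψ) = (ψe₁ - e₁ψ) ⊗ 1 + 1 ⊗ (ψe₁ - e₁ψ)`. [folklore] -/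
theorem delta_derivI_X {ψ : WordSeries Bool B} (hψ : delta ψ = tensor ψ 1 + tensor 1 ψ) (k : Bool) :
    delta (derivI ψ (X k)) = tensor (derivI ψ (X k)) 1 + tensor 1 (derivI ψ (X k)) := by
  cases k with
  | false => rw [derivI_X_false, delta_zero, tensor_zero_left, tensor_zero_right, add_zero]
  | true =>
    rw [derivI_X_true, delta_sub, delta_mul, delta_mul, hψ, delta_X, tensor_sub_left,
      tensor_sub_right]
    simp only [add_mul, mul_add, tensor_mul_tensor, one_mul, mul_one]
    abel

/-- **Coderivation property of `s_ψ` on word monomials** (`ψ` primitive):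
`δ(s_ψ X_c) = (s_ψ ⊗ id + id ⊗ s_ψ)(δ X_c)`. [folklore] -/
theorem delta_sI_wordX {ψ : WordSeries Bool B} (hψ : delta ψ = tensor ψ 1 + tensor 1 ψ)
    (c : List Bool) :
    delta (sI ψ (wordX c)) = mapOuter (sIHom ψ) (delta (wordX c)) + mapInner (sIHom ψ) (delta (wordX c)) := by
  have hD : delta (derivI ψ (wordX c)) =
      mapOuter (derivIHom ψ) (delta (wordX c)) + mapInner (derivIHom ψ) (delta (wordX c)) :=
    delta_deriv_wordX (D := derivIHom ψ) (fun x y => derivI_mul ψ x y)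
      (fun r x => derivI_C_mul ψ r x) (fun k => delta_derivI_X hψ k) c
  have hO : ∀ Z : WordSeries Bool (WordSeries Bool B), mapOuter (sIHom ψ) Z =
      mapOuter (AddMonoidHom.mulRight ψ) Z + mapOuter (derivIHom ψ) Z := fun Z => rfl
  have hI : ∀ Z : WordSeries Bool (WordSeries Bool B), mapInner (sIHom ψ) Z =
      mapInner (AddMonoidHom.mulRight ψ) Z + mapInner (derivIHom ψ) Z := fun Z => rfl
  rw [hO, hI, sI, delta_add, delta_mul_of_prim hψ, hD]
  abel

/-! ### Extension to homogeneous series (finite combinations of words) -/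

/-- All binary words of length `n`. [folklore] -/
def allWords : ℕ → Finset (List Bool)
  | 0 => {[]}
  | n + 1 => (allWords n).image (List.cons false) ∪ (allWords n).image (List.cons true)

/-- `c ∈ allWords n ↔ |c| = n`. [folklore] -/
theorem mem_allWords : ∀ {n : ℕ} {c : List Bool}, c ∈ allWords n ↔ c.length = n
  | 0, c => by
    rw [allWords, Finset.mem_singleton, List.length_eq_zero_iff]
  | n + 1, [] => by
    simp only [allWords, Finset.mem_union, Finset.mem_image, List.length_nil]
    constructor
    · rintro (⟨_, _, h⟩ | ⟨_, _, h⟩) <;> exact absurd h (List.cons_ne_nil _ _)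
    · intro h; omega
  | n + 1, k :: c => by
    simp only [allWords, Finset.mem_union, Finset.mem_image, List.cons.injEq, List.length_cons,
      Nat.add_right_cancel_iff]
    constructor
    · rintro (⟨c', hc', -, rfl⟩ | ⟨c', hc', -, rfl⟩) <;> exact mem_allWords.1 hc'
    · intro h
      cases k
      · exact Or.inl ⟨c, mem_allWords.2 h, rfl, rfl⟩
      · exact Or.inr ⟨c, mem_allWords.2 h, rfl, rfl⟩

/-- **A homogeneous series is a finite combination of word monomials.** [folklore] -/
theorem eq_sum_of_isWt {x : WordSeries Bool B} {n : ℕ} (hx : IsWt x n) :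
    x = ∑ c ∈ allWords n, C (x c) * wordX c := by
  ext w
  rw [finset_sum_apply]
  simp_rw [C_mul_apply, wordX_apply, mul_ite, mul_one, mul_zero]
  rw [Finset.sum_ite_eq]
  split_ifs with h
  · rfl
  · exact hx.apply_eq_zero fun h' => h (mem_allWords.2 h')

/-- **Coderivation property of `s_ψ` on homogeneous series** (`ψ` primitive):
`δ(s_ψ x) = (s_ψ ⊗ id + id ⊗ s_ψ)(δ x)`. [folklore] -/
theorem delta_sI_of_isWt {ψ : WordSeries Bool B} (hψ : delta ψ = tensor ψ 1 + tensor 1 ψ)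
    {x : WordSeries Bool B} {n : ℕ} (hx : IsWt x n) :
    delta (sI ψ x) = mapOuter (sIHom ψ) (delta x) + mapInner (sIHom ψ) (delta x) := by
  have hC : ∀ (r : B) (y : WordSeries Bool B), sIHom ψ (C r * y) = C r * sIHom ψ y := sI_C_mul ψ
  rw [eq_sum_of_isWt hx, sI_sum, delta_sum, delta_sum, mapOuter_sum, mapInner_sum,
    ← Finset.sum_add_distrib]
  refine Finset.sum_congr rfl fun c _ => ?_
  rw [sI_C_mul, delta_mul, delta_mul, delta_C, mapOuter_CC_mul hC, mapInner_CC_mul hC,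
    delta_sI_wordX hψ, mul_add]

/-- **`W ↦ P_W` is a coalgebra map**: for primitive homogeneous generators,
`δ P_W = Σ_{(U,V) deshuffle of W} P_U ⊗ P_V` — the transpose of "the orbit map
`𝒪(₀Π₁) → 𝒰'`, `w ↦ Σ_W P_W(w) F_W`, is a homomorphism for the shuffle products".
[cite: Brown2012, §2.1 (2.6), §2.5; DeligneGoncharov2005, Prop. 5.11] -/
theorem delta_PW {τ : ℕ → WordSeries Bool B} (hτp : ∀ a, delta (τ a) = tensor (τ a) 1 + tensor 1 (τ a))
    (hτw : ∀ a, IsWt (τ a) a) : ∀ W : List ℕ,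
    delta (PW τ W) = ((desh W).map fun de => tensor (PW τ de.1) (PW τ de.2)).sum
  | [] => by simp [desh]
  | a :: W => by
    rw [PW_cons, delta_sI_of_isWt (hτp a) (isWt_PW hτw W), delta_PW hτp hτw W, desh, List.map_append,
      List.sum_append, List.map_map, List.map_map, ← mapOuterHom_apply, ← mapInnerHom_apply,
      map_list_sum, map_list_sum, List.map_map, List.map_map]
    have hC : ∀ (r : B) (y : WordSeries Bool B), sIHom (τ a) (C r * y) = C r * sIHom (τ a) y :=
      sI_C_mul (τ a)
    congr 1
    · refine congrArg List.sum (List.map_congr_left fun de _ => ?_)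
      simp only [Function.comp_apply, mapOuterHom_apply]
      rw [mapOuter_tensor hC]; rfl
    · refine congrArg List.sum (List.map_congr_left fun de _ => ?_)
      simp only [Function.comp_apply, mapInnerHom_apply]
      rw [mapInner_tensor hC]; rfl

end CoDeriv

end GoncharovFormalIteratedIntegrals

end Literature.NumberTheory.Transcendental
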